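import Mathlib
import HarnessLib
import Summits.CriticalPhenomena.Ising3DConformalLimit.Theorems.HarmonicMomentsIsotropyTwoPointAsymptoticIsotropyPairLimit
import Summits.CriticalPhenomena.Ising3DConformalLimit.Theorems.HarmonicMomentsIsotropyTwoPointAsymptoticIsotropy
import Summits.CriticalPhenomena.Ising3DConformalLimit.Theorems.HarmonicMomentsIsotropyTwoPointAsymptoticIsotropyTestFunctions
import Summits.CriticalPhenomena.Ising3DConformalLimit.Theorems.MoebiusLimitOfTwoPointLaw.Negative.TwoPointConvergence
import Literature.Probability.LatticeModels.CriticalTwoPointLawDimension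
import Summits.CriticalPhenomena.Ising3DConformalLimit.Theses.HarmonicMomentsIsotropy
import Summits.CriticalPhenomena.Ising3DConformalLimit.Theses.IsingEuclidUpgrade

/-!
# Vague asymptotic isotropy of the critical `ℤ³` two-point function, VIII:
# the ratio theorem from PAIR data, and `IsingEuclidUpgradeR2RotInvPowerLaw → TwoPointAsymptoticIsotropy`
(route HarmonicMomentsIsotropy, support item stmt-CriticalPhenomena-6036 `TwoPointAsymptoticIsotropy`;
main file of the second conditional line, item stmt-CriticalPhenomena-0634 ⇒ item stmt-CriticalPhenomena-6036)

THE RESULTS.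
* `tendsto_bulkSum₂` — the bulk convergence of file VII for the cut-off test function `shell[ε,M]·φ`.
* `tendsto_ratio_of_pairLimit` — the ratio theorem of file VI (`tendsto_ratio_of_limit`) under PAIR
  hypotheses only: if the renormalised critical pair correlator `ρ(δ)²⟨σ_{[a/δ]}σ_{[b/δ]}⟩_{β_c}` of the
  nearest-neighbour Ising model on `ℤ³` converges locally uniformly off the diagonal to `S 2` (`ρ > 0` on
  `(0,1]`), `S` is scale covariant with `Δ ≤ 1`, and the kernel `K(y) = S₂(0,y)` is continuous and
  positive off `0` and invariant under a linear isometry `T`, then for every continuous `φ ≥ 0`, bounded,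
  vanishing outside a ball and positive somewhere,
  `Σ_x φ(T(x/L))⟨σ₀σ_x⟩_{β_c} / Σ_x φ(x/L)⟨σ₀σ_x⟩_{β_c} → 1` (`L → ∞`). Same proof as file VI (dyadic
  split at `‖x‖ = 2^{-J}L`, bulk by Riemann sums + dominated convergence, origin by the geometric decay of
  the lattice mass from the shell ratio `2^{2Δ-3} ≤ 1/2 < 2/3`), fed by the pair-only lemmas of file VII.
* `tendsto_ratio_of_powerLaw` — the instance given by the ISOTROPIC PURE POWER LAW
  `⟨σ₀σ_x⟩_{β_c}‖x‖₂^{2Δ} → c > 0` (cofinitely on `ℤ³`): with the canonical renormalisation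
  `ρ(δ) = δ^{-Δ}` the pair correlator converges locally uniformly to `c‖a−b‖^{-2Δ}` (tree theorem
  `tendstoLocallyUniformlyOn_arity_two_of_twoPointLaw`), `1/2 ≤ Δ ≤ 1` (tree theorem
  `twoPointLaw_exponent_mem_Icc`, from `c‖x‖⁻² ≤ ⟨σ₀σ_x⟩_{β_c} ≤ C‖x‖⁻¹`), and the kernel `c‖y‖^{-2Δ}` is
  continuous, positive and `O(3)`-invariant; the auxiliary family `S` is `c‖z₀−z₁‖^{-2Δ}` in arity `2`
  and `0` otherwise (scale covariant with dimension `Δ`).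
* `twoPointAsymptoticIsotropy_of_rotInvPowerLaw :
  Theses.IsingEuclidUpgrade.IsingEuclidUpgradeR2RotInvPowerLaw → TwoPointAsymptoticIsotropy` — both route decls
  verbatim: item 0634 (crux r2 of route IsingEuclidUpgrade, wanted by five routes) implies the milestone
  item 6036, as its informal statement asserts ("the lattice, test-function form of the rotational half of
  item 0634"). This is a SECOND, independent upstream of item 6036 besides the shared existence crux
  `ExistsScaleCovariantLimit` (item 1981, file VI): item 0634 controls the pair correlator only and needs no
  reflection-positivity rigidity, item 1981 controls all arities but allows a slowly varying
  renormalisation. The unconditional statement stays open (Duminil-Copin, ICM 2022, §8.1).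

References: H. Duminil-Copin, *100 years of the (critical) Ising model on the hypercubic lattice*, ICM 2022,
§8.1 p. 25 [DuminilCopinICM2022]; G. B. Folland, *Real Analysis* (1999), §2.3. No definitions are
introduced.
-/

noncomputable section

namespace Summit.CriticalPhenomena.Ising3DConformalLimit.HarmonicMomentsIsotropyTwoPoint

open Literature.Probability.LatticeModels MeasureTheory Filter Set Metric
open scoped Topology
open Summit.CriticalPhenomena.Ising3DConformalLimit.HyperoctahedralRPTwoPoint
open Summit.CriticalPhenomena.Ising3DConformalLimit.Theses.HarmonicMomentsIsotropy
open Summit.CriticalPhenomena.Ising3DConformalLimit.Theorems.MoebiusLimitOfTwoPointLaw.Negative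
  (tendstoLocallyUniformlyOn_arity_two_of_twoPointLaw)
open Literature.Barriers.CriticalPhenomena.ScaleNotMoebius (twoPt twoPt_smul)

/-- The indicator of the spherical shell `{a < ‖y‖ ≤ b}`. -/
local notation3 (prettyPrint := false) "shell[" a "," b "]" =>
  Set.indicator {y : EuclideanSpace ℝ (Fin 3) | a < ‖y‖ ∧ ‖y‖ ≤ b} (fun _ => (1:ℝ))

/-- The indicator of the closed ball `{‖y‖ ≤ r}`. -/
local notation3 (prettyPrint := false) "ballInd[" r "]" =>
  Set.indicator {y : EuclideanSpace ℝ (Fin 3) | ‖y‖ ≤ r} (fun _ => (1:ℝ))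

variable {ρ : ℝ → ℝ} {Δ : ℝ} {S : CorrFamily 3}

/-! ### The bulk convergence for cut-off test functions -/

/-- The bulk test function `shell[ε,M]·φ` satisfies the hypotheses of the bulk convergence theorem
(pair-limit form of `tendsto_bulkSum`). [folklore] -/
theorem tendsto_bulkSum₂
    (hlim2 : TendstoLocallyUniformlyOn (rescaledCorrelator (criticalCorr 3) ρ 2) (S 2) (𝓝[>] (0:ℝ))
      (NonCoincident 3 2))
    {φ : EuclideanSpace ℝ (Fin 3) → ℝ} (hφc : Continuous φ) {B M ε : ℝ} (hB : ∀ y, |φ y| ≤ B)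
    (hε : 0 < ε) :
    Tendsto (fun L : ℝ => (L⁻¹) ^ 3 * ρ L⁻¹ ^ 2 *
        ∑' x : Site 3, shell[ε, M] (L⁻¹ • siteVec x) * φ (L⁻¹ • siteVec x) * criticalTwoPoint 3 x)
      atTop (𝓝 (∫ y, shell[ε, M] y * (φ y * S 2 ![0, y]))) := by
  have hB0 : 0 ≤ B := (abs_nonneg _).trans (hB 0)
  have h := tendsto_scaled_latticeSum₂ hlim2 (Ψ := fun y => shell[ε, M] y * φ y) (B := B) (ε := ε)
    (M := M) (fun y => ?_) hε (fun y hy => ?_) (fun y hy => ?_) ?_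
  · have h' := h.comp tendsto_inv_atTop_nhdsGT_zero
    have heq : (∫ y, shell[ε, M] y * φ y * S 2 ![0, y]) =
        ∫ y, shell[ε, M] y * (φ y * S 2 ![0, y]) :=
      integral_congr_ae (Eventually.of_forall fun y => mul_assoc _ _ _)
    rw [heq] at h'
    exact h'
  · rw [abs_mul]
    calc |shell[ε, M] y| * |φ y| ≤ 1 * B :=
          mul_le_mul (abs_shell_le _ _ _) (hB y) (abs_nonneg _) zero_le_one
      _ = B := one_mul B
  · show shell[ε, M] y * φ y = 0
    rw [shell_eq_zero_of_lt hy, zero_mul]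
  · show shell[ε, M] y * φ y = 0
    rw [shell_eq_zero_of_gt hy, zero_mul]
  · filter_upwards [ae_continuousAt_shell ε M] with y hy
    exact hy.mul hφc.continuousAt

/-! ### The ratio theorem from pair data -/

/-- **The ratio theorem from pair data.** Let the renormalised critical pair correlator of `ℤ³`
converge locally uniformly off the diagonal to `S 2` (renormalisation `ρ > 0` on `(0,1]`), let `S` be
scale covariant with dimension `Δ ≤ 1`, and let the kernel `K(y) = S₂(0,y)` be continuous and positive
off the origin and invariant under the linear isometry `T` of `ℝ³`. Then for every continuous `φ ≥ 0` on
`ℝ³`, bounded, vanishing outside a ball and positive somewhere,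
`Σ_x φ(T(x/L)) ⟨σ₀σ_x⟩_{β_c} / Σ_x φ(x/L) ⟨σ₀σ_x⟩_{β_c} → 1` as `L → ∞`.
Proof: that of `tendsto_ratio_of_limit` (file VI) with the pair-only inputs of file VII — split both
sums at `‖x‖ = 2^{-J} L`; the bulk parts, multiplied by `L⁻³ρ(1/L)²`, converge to
`∫_{‖y‖>2^{-J}} φ∘T · K = ∫_{‖y‖>2^{-J}} φ K > 0`; the origin parts are at most
`‖φ‖_∞ (m₀ + 3(2/3)^J Σ_{L/2<‖x‖≤L})`, i.e. `O((2/3)^J)` relative to the bulk, uniformly in large `L`.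
[cite: DuminilCopinICM2022, §8.1] -/
theorem tendsto_ratio_of_pairLimit (hρ : ∀ δ ∈ Set.Ioc (0:ℝ) 1, 0 < ρ δ)
    (hlim2 : TendstoLocallyUniformlyOn (rescaledCorrelator (criticalCorr 3) ρ 2) (S 2) (𝓝[>] (0:ℝ))
      (NonCoincident 3 2))
    (hsc : IsScaleCovariant Δ S) (hΔ1 : Δ ≤ 1)
    (hKcont : ContinuousOn (fun y : EuclideanSpace ℝ (Fin 3) => S 2 ![0, y]) {0}ᶜ)
    (hKpos : ∀ y : EuclideanSpace ℝ (Fin 3), y ≠ 0 → 0 < S 2 ![0, y])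
    {T : EuclideanSpace ℝ (Fin 3) ≃ₗᵢ[ℝ] EuclideanSpace ℝ (Fin 3)}
    (hKT : ∀ y : EuclideanSpace ℝ (Fin 3), S 2 ![0, T y] = S 2 ![0, y])
    {φ : EuclideanSpace ℝ (Fin 3) → ℝ} (hφc : Continuous φ) {B M : ℝ} (hB : ∀ y, |φ y| ≤ B)
    (hφM : ∀ y, M < ‖y‖ → φ y = 0) (hφ0 : ∀ y, 0 ≤ φ y) (hφpos : ∃ y, 0 < φ y) :
    Tendsto (fun L : ℝ => (∑' x : Site 3, φ (T (L⁻¹ • siteVec x)) * criticalTwoPoint 3 x) /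
      (∑' x : Site 3, φ (L⁻¹ • siteVec x) * criticalTwoPoint 3 x)) atTop (𝓝 1) := by
  have hB0 : 0 ≤ B := (abs_nonneg _).trans (hB 0)
  -- the rotated test function
  have hφTc : Continuous fun y => φ (T y) := hφc.comp T.continuous
  have hφTM : ∀ y, M < ‖y‖ → φ (T y) = 0 := fun y hy =>
    hφM _ (by rwa [LinearIsometryEquiv.norm_map])
  have hφTB : ∀ y, |φ (T y)| ≤ B := fun y => hB _
  have hφT0 : ∀ y, 0 ≤ φ (T y) := fun y => hφ0 _
  -- the positivity scale `ε₁` and `I₁ > 0` (all real constants below are kept opaque)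
  obtain ⟨ε₁, hε₁, hI₁'⟩ := exists_pos_bulk_integral hKcont hKpos hφc hφM hφ0 hφpos
  obtain ⟨I₁, hI₁def⟩ : ∃ I : ℝ, I = ∫ y, shell[ε₁, M] y * (φ y * S 2 ![0, y]) := ⟨_, rfl⟩
  have hI₁ : 0 < I₁ := by rw [hI₁def]; exact hI₁'
  -- the shell-ratio scale `L₀` and the core mass `m₀`
  obtain ⟨L₀, hL₀1, hratio⟩ := exists_ratio_scale₂ hρ hlim2 hsc hΔ1 hKcont hKpos
  have hL₀ : 0 < L₀ := one_pos.trans_le hL₀1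
  obtain ⟨m₀, hm₀def⟩ :
      ∃ m : ℝ, m = ∑' x : Site 3, ballInd[L₀] (siteVec x) * criticalTwoPoint 3 x := ⟨_, rfl⟩
  have hm₀0 : 0 ≤ m₀ := by rw [hm₀def]; exact mass_nonneg L₀
  obtain ⟨J₁₂, hJ₁₂def⟩ : ∃ I : ℝ, I = ∫ y, shell[1 / 2, 1] y * S 2 ![0, y] := ⟨_, rfl⟩
  -- the two model limits along `L → ∞`
  have hc0 : Tendsto (fun L : ℝ => (L⁻¹) ^ 3 * ρ L⁻¹ ^ 2) atTop (𝓝 0) :=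
    (tendsto_cube_mul_rho_sq₂ hlim2).comp tendsto_inv_atTop_nhdsGT_zero
  have hD : Tendsto (fun L : ℝ => (L⁻¹) ^ 3 * ρ L⁻¹ ^ 2 *
      ∑' x : Site 3, shell[1 / 2, 1] (L⁻¹ • siteVec x) * criticalTwoPoint 3 x) atTop (𝓝 J₁₂) := by
    rw [hJ₁₂def]
    exact (tendsto_shellSum₂ hlim2 (a := 1 / 2) (b := 1) (by norm_num)).comp
      tendsto_inv_atTop_nhdsGT_zero
  have hJ₁₂0 : 0 ≤ J₁₂ := by
    refine ge_of_tendsto hD ?_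
    filter_upwards [eventually_ge_atTop (1:ℝ)] with L hL
    have hLpos : 0 < L := one_pos.trans_le hL
    exact mul_nonneg (mul_nonneg (pow_nonneg (inv_nonneg.2 hLpos.le) 3) (sq_nonneg _))
      (tsum_nonneg fun x => mul_nonneg (Set.indicator_nonneg (fun _ _ => zero_le_one) _)
        (criticalTwoPoint_nonneg' x))
  -- ε-criterion
  rw [Metric.tendsto_nhds]
  intro η hη
  -- the dyadic depth `J` and the inner radius `ε = 2^{-J}`
  obtain ⟨J, hJ1, hJ2⟩ := exists_depth (a := 2 * B * (3 * (J₁₂ + 1))) (t := η * I₁ / 8)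
    (by positivity) (by positivity) hε₁
  set ε : ℝ := ((2:ℝ) ^ J)⁻¹ with hεdef
  have hε : 0 < ε := by positivity
  obtain ⟨Iε, hIεdef⟩ : ∃ I : ℝ, I = ∫ y, shell[ε, M] y * (φ y * S 2 ![0, y]) := ⟨_, rfl⟩
  have hIε : I₁ ≤ Iε := by
    rw [hI₁def, hIεdef]
    exact bulk_integral_mono hKcont hKpos hφc hφ0 hε hJ2
  -- bulk limits (the rotated one has the same limit: `T`-invariance of `K` and of Lebesgue measure)
  have hb1 := tendsto_bulkSum₂ hlim2 hφc (M := M) (ε := ε) hB hε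
  rw [← hIεdef] at hb1
  have hbT := tendsto_bulkSum₂ hlim2 hφTc (M := M) (ε := ε) hφTB hε
  rw [bulk_integral_comp_isometry T hKT φ ε M, ← hIεdef] at hbT
  -- eventualities along `L → ∞`
  have e1 := eventually_ge_atTop L₀
  have hsmall : 0 < η * I₁ / 16 := by positivity
  have e2 := (tendsto_order.1 hb1).1 _ (show Iε - η * I₁ / 16 < Iε by linarith)
  have e3 := (tendsto_order.1 hb1).2 _ (show Iε < Iε + η * I₁ / 16 by linarith)
  have e4 := (tendsto_order.1 hbT).1 _ (show Iε - η * I₁ / 16 < Iε by linarith)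
  have e5 := (tendsto_order.1 hbT).2 _ (show Iε < Iε + η * I₁ / 16 by linarith)
  have e2' := (tendsto_order.1 hb1).1 _ (show Iε - I₁ / 2 < Iε by linarith)
  have e6 : ∀ᶠ L : ℝ in atTop, (L⁻¹) ^ 3 * ρ L⁻¹ ^ 2 * m₀ < η * I₁ / (16 * (B + 1)) := by
    have h := hc0.mul_const m₀
    rw [zero_mul] at h
    exact (tendsto_order.1 h).2 _ (by positivity)
  have e7 := (tendsto_order.1 hD).2 _ (show J₁₂ < J₁₂ + 1 by linarith)
  filter_upwards [e1, e2, e3, e4, e5, e2', e6, e7] with L hL1 h2 h3 h4 h5 h2' h6 h7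
  -- facts about the pieces at scale `L` (with the explicit terms)
  have hLpos : 0 < L := hL₀.trans_le hL1
  have hL1' : 1 ≤ L := hL₀1.trans hL1
  have hc : 0 < (L⁻¹) ^ 3 * ρ L⁻¹ ^ 2 := mul_pos (pow_pos (inv_pos.2 hLpos) 3)
    (pow_pos (hρ _ ⟨inv_pos.2 hLpos, inv_le_one_of_one_le₀ hL1'⟩) 2)
  have hN1 := tsum_sample_eq_bulk_add_origin hLpos hφM ε
  have hNT := tsum_sample_eq_bulk_add_origin (φ := fun y => φ (T y)) hLpos hφTM ε
  have ho1 := origin_nonneg hφ0 ε L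
  have hoT := origin_nonneg hφT0 ε L
  have hεL : ε * L = L / 2 ^ J := by rw [hεdef, inv_mul_eq_div]
  have ho1le := origin_le_mass (ε := ε) hLpos hB hφM
  have hoTle := origin_le_mass (φ := fun y => φ (T y)) (ε := ε) hLpos hφTB hφTM
  rw [hεL] at ho1le hoTle
  have hmJ := mass_dyadic_le hL₀ hratio hL1 J
  rw [← hm₀def] at hmJ
  rw [Real.dist_eq, hN1, hNT]
  exact ratio_arith hc hB0 hη hI₁ hIε h2 h3 h4 h5 h2' h6 h7 ho1 hoT ho1le hoTle hmJ
    (by positivity) hJ1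

/-! ### The instance of the isotropic pure power law (item 0634) -/

/-- **The ratio theorem under the two-point power law.** If `⟨σ₀σ_x⟩_{β_c} ‖x‖₂^{2Δ} → c > 0`
cofinitely on `ℤ³`, then for every continuous `φ ≥ 0` on `ℝ³`, bounded, vanishing outside a ball and
positive somewhere, and every linear isometry `T` of `ℝ³`,
`Σ_x φ(T(x/L)) ⟨σ₀σ_x⟩_{β_c} / Σ_x φ(x/L) ⟨σ₀σ_x⟩_{β_c} → 1` as `L → ∞`: with `ρ(δ) = δ^{-Δ}` the pair
correlator converges locally uniformly to `c‖a−b‖^{-2Δ}` (`tendstoLocallyUniformlyOn_arity_two_of_twoPointLaw`),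
`Δ ≤ 1` (`twoPointLaw_exponent_mem_Icc`), and the kernel `c‖y‖^{-2Δ}` is continuous, positive and
isometry invariant, so `tendsto_ratio_of_pairLimit` applies to the family equal to `c‖z₀−z₁‖^{-2Δ}` in
arity `2` and to `0` in the other arities. [cite: DuminilCopinICM2022, §8.1] -/
theorem tendsto_ratio_of_powerLaw {Δ c : ℝ} (hc : 0 < c)
    (hP : Tendsto (fun x : Site 3 =>
      criticalTwoPoint 3 x * Real.sqrt (∑ i, ((x i : ℝ)) ^ 2) ^ (2 * Δ)) cofinite (𝓝 c))
    (T : EuclideanSpace ℝ (Fin 3) ≃ₗᵢ[ℝ] EuclideanSpace ℝ (Fin 3))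
    {φ : EuclideanSpace ℝ (Fin 3) → ℝ} (hφc : Continuous φ) {B M : ℝ} (hB : ∀ y, |φ y| ≤ B)
    (hφM : ∀ y, M < ‖y‖ → φ y = 0) (hφ0 : ∀ y, 0 ≤ φ y) (hφpos : ∃ y, 0 < φ y) :
    Tendsto (fun L : ℝ => (∑' x : Site 3, φ (T (L⁻¹ • siteVec x)) * criticalTwoPoint 3 x) /
      (∑' x : Site 3, φ (L⁻¹ • siteVec x) * criticalTwoPoint 3 x)) atTop (𝓝 1) := by
  -- the auxiliary family: `c‖z₀ - z₁‖^{-2Δ}` in arity `2`, `0` otherwise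
  obtain ⟨S, hS2, hsc⟩ : ∃ S : CorrFamily 3,
      (S 2 = fun z => c * twoPt Δ (z 0) (z 1)) ∧ IsScaleCovariant Δ S := by
    refine ⟨fun n z => if h : n = 2 then c * twoPt Δ (z ⟨0, by omega⟩) (z ⟨1, by omega⟩) else 0,
      ?_, ?_⟩
    · funext z
      dsimp only
      rw [dif_pos rfl]
      rfl
    · intro n a ha z
      by_cases hn : n = 2
      · subst hn
        dsimp only
        rw [dif_pos rfl, dif_pos rfl, twoPt_smul Δ ha,
          show (-((2:ℕ) : ℝ) * Δ) = -(2 * Δ) by push_cast; ring]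
        ring
      · dsimp only
        rw [dif_neg hn, dif_neg hn, mul_zero]
  set ρ' : ℝ → ℝ := fun δ => δ ^ (-Δ) with hρ'
  have hlim2 : TendstoLocallyUniformlyOn (rescaledCorrelator (criticalCorr 3) ρ' 2) (S 2)
      (𝓝[>] (0:ℝ)) (NonCoincident 3 2) := by
    rw [hS2]
    exact tendstoLocallyUniformlyOn_arity_two_of_twoPointLaw hc hP
  have hK : ∀ y : EuclideanSpace ℝ (Fin 3), S 2 ![0, y] = c * ‖y‖ ^ (-(2 * Δ)) := by
    intro y
    rw [hS2]
    simp only [Matrix.cons_val_zero, Matrix.cons_val_one, Matrix.cons_val_fin_one, twoPt, zero_sub,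
      norm_neg]
  have hρ : ∀ δ ∈ Set.Ioc (0:ℝ) 1, 0 < ρ' δ := fun δ hδ => Real.rpow_pos_of_pos hδ.1 _
  have hΔ1 : Δ ≤ 1 := (twoPointLaw_exponent_mem_Icc hc hP).2
  have hKfun : (fun y : EuclideanSpace ℝ (Fin 3) => S 2 ![0, y]) = fun y => c * ‖y‖ ^ (-(2 * Δ)) :=
    funext hK
  have hKcont : ContinuousOn (fun y : EuclideanSpace ℝ (Fin 3) => S 2 ![0, y]) {0}ᶜ := by
    rw [hKfun]
    exact continuousOn_const.mul
      (continuous_norm.continuousOn.rpow_const fun y hy => Or.inl (norm_ne_zero_iff.2 hy))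
  have hKpos : ∀ y : EuclideanSpace ℝ (Fin 3), y ≠ 0 → 0 < S 2 ![0, y] := fun y hy => by
    rw [hK]
    exact mul_pos hc (Real.rpow_pos_of_pos (norm_pos_iff.2 hy) _)
  have hKT : ∀ y : EuclideanSpace ℝ (Fin 3), S 2 ![0, T y] = S 2 ![0, y] := fun y => by
    rw [hK, hK, LinearIsometryEquiv.norm_map]
  exact tendsto_ratio_of_pairLimit hρ hlim2 hsc hΔ1 hKcont hKpos hKT hφc hB hφM hφ0 hφpos

/-! ### The second conditional milestone: item 0634 ⇒ item 6036 -/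

/-- **`IsingEuclidUpgradeR2RotInvPowerLaw → TwoPointAsymptoticIsotropy`** (item
stmt-CriticalPhenomena-0634 ⇒ item stmt-CriticalPhenomena-6036; both route decls verbatim). If the
critical two-point function of the nearest-neighbour Ising model on `ℤ³` is asymptotically an isotropic
pure power law, `⟨σ₀σ_x⟩_{β_c(3)} ‖x‖₂^{2Δ} → c > 0` as `x → ∞`, then it is asymptotically `O(3)`-invariant
in the vague sense: for every continuous compactly supported `φ ≥ 0`, `φ ≢ 0`, on `ℝ³` and every
orthogonal matrix `R`, `Σ_x φ(Rx/L)⟨σ₀σ_x⟩_{β_c} / Σ_x φ(x/L)⟨σ₀σ_x⟩_{β_c} → 1` (`L → ∞`)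
(`tendsto_ratio_of_powerLaw`, the orthogonal matrix acting as a linear isometry of
`EuclideanSpace ℝ (Fin 3)`). Both the hypothesis (item 0634) and the conclusion are open on `ℤ³`
(Duminil-Copin, ICM 2022, §8.1); this records that item 6036 is the weaker of the two.
[cite: DuminilCopinICM2022, §8.1] -/
theorem twoPointAsymptoticIsotropy_of_rotInvPowerLaw
    (hP : Theses.IsingEuclidUpgrade.IsingEuclidUpgradeR2RotInvPowerLaw) :
    TwoPointAsymptoticIsotropy := by
  obtain ⟨Δ, c, hc, hPt⟩ := hP
  intro φ hφc hφs hφ0 hφpos R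
  -- the orthogonal matrix as a linear isometry of `EuclideanSpace ℝ (Fin 3)`
  obtain ⟨T, hT⟩ := exists_linearIsometryEquiv_of_orthogonal R
  -- the test function on `EuclideanSpace ℝ (Fin 3)`
  set φE : EuclideanSpace ℝ (Fin 3) → ℝ := fun y => φ y.ofLp with hφE
  have hφEc : Continuous φE := hφc.comp (PiLp.continuous_ofLp 2 _)
  obtain ⟨B, hB⟩ : ∃ B, ∀ y, |φE y| ≤ B := by
    obtain ⟨C, hC⟩ := hφc.bounded_above_of_compact_support hφs
    exact ⟨C, fun y => by rw [← Real.norm_eq_abs]; exact hC _⟩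
  obtain ⟨M₀, hM₀⟩ : ∃ M₀ : ℝ, ∀ v : Fin 3 → ℝ, M₀ < ‖v‖ → φ v = 0 := by
    obtain ⟨C, hC⟩ := hφs.isCompact.isBounded.exists_norm_le
    refine ⟨C, fun v hv => image_eq_zero_of_notMem_tsupport fun hmem => ?_⟩
    exact absurd (hC v hmem) (not_le.2 hv)
  have hφEM : ∀ y : EuclideanSpace ℝ (Fin 3), 2 * M₀ < ‖y‖ → φE y = 0 := by
    intro y hy
    refine hM₀ _ ?_
    have := norm_le_two_mul_norm_ofLp y
    linarith
  have hφE0 : ∀ y, 0 ≤ φE y := fun y => hφ0 _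
  have hφEpos : ∃ y, 0 < φE y := by
    obtain ⟨v, hv⟩ := hφpos
    exact ⟨WithLp.toLp 2 v, by simpa [hφE] using hv⟩
  have hmain := tendsto_ratio_of_powerLaw hc hPt T hφEc hB hφEM hφE0 hφEpos
  -- identify the sums
  refine hmain.congr fun L => ?_
  have h1 : ∀ x : Site 3, φE (T (L⁻¹ • siteVec x)) =
      φ (L⁻¹ • (R.1.mulVec fun i => (x i : ℝ))) := by
    intro x
    simp only [hφE, hT, WithLp.ofLp_smul, Matrix.mulVec_smul]
    rfl
  have h2 : ∀ x : Site 3, φE (L⁻¹ • siteVec x) = φ (L⁻¹ • fun i => (x i : ℝ)) := by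
    intro x
    simp only [hφE, WithLp.ofLp_smul]
    rfl
  simp only [h1, h2]

end Summit.CriticalPhenomena.Ising3DConformalLimit.HarmonicMomentsIsotropyTwoPoint

end
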